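import Summits.QuantumFields.YangMills.Theorems.BalabanUVNodesN15SiteScalarLayerDressed
import Summits.QuantumFields.YangMills.Theorems.BalabanUVNodesN15FullPropagatorExactSiteSocketWordsF
import HarnessLib

/-!
# Route «BalabanUVNodes», cluster K4 «SpineRates» — node N15 = NE2: THE SITE LAYER WITH THE BACKGROUND LIVE IN THE TwoGrid ENTRY CURRENCY, XIII — PART IX WITH THE AVERAGING SPECIES
# LIVE: the sockets' three letters and `NE2PlusSite` from a scalar-site species' three diagonal letters AND an averaging species' six block-local letters (`F₂ = Q′(U′U) − Q′`,
# `F₂* = Q′*(U′U) − Q′*` of [B9] (3.58)∕(3.65), part VI's words) — every `U ≡ 1` hypothesis DISCHARGED on the genuine massless scalar site propagator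

Cell `pub-ymgap`, WIDTH SEAT `pub-ymgap-dag-n15-w1` (generation 2; director-ym №197 ∕ HUMAN RULING D-0149; chair R455 (A) ∕ R461; plan g81∕g82 `W-SEAT-START-LIST.md` §n15).  `bears_on:
R4∕N15 · K3⁷ SpineGivenEndpointR13SepCoPH (stmt-QuantumFields-20544)`.  Filed `--kind proof --supports stmt-QuantumFields-20544 --as helper` — COUNT-NEUTRAL.  THEOREMS ONLY (0 `def`,
0 `sorry`).  Imports this seat's part IX `…N15SiteScalarLayerDressed` and part VI `…N15FullPropagatorExactSiteSocketWordsF` (`sitePert365F`, `siteLettersF_of_dressedLetters`,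
`ne2PlusSite_sSiteExOn_of_dressedLettersF`) BY NAME; nothing in the tree is modified.

WHY.  Part IX discharged the `U ≡ 1` half of part V's socket bridge (averaging species dropped, `F₂ = 0` — right for a scalar model whose block averaging does not see the background).
Bałaban's `Q′(U)` DOES see it ([Balaban1985BackgroundPropagators] (3.58) p.402: `Q′(U′U) = Q′(U) + F′₂(A)`), and part VI typed the site words with `F₂, F₂*` LIVE over HYPOTHETICAL
layers.  THIS FILE is part VI with the `U ≡ 1` scalar layer the GENUINE massless one (parts VII∕VIII) and the dressing dag-n15-c S4's — so the remaining inputs are EXACTLY a lane's two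
species: the first-order `V̂` (three diagonal letters) and the averaging pair `F₂, F₂*` (sizes `≤ diagK (r₀α₀)`, fits `≤ diagK (o₀(L^k)^{−γ∕2})`).

CONTENTS.  §1 ★★★ `siteLettersF_of_speciesLetters` (part IX §2's proof feeding part VI's `siteLettersF_of_dressedLetters`; threshold `a₁ ∧ a₂ ∧ (2βKc_r + 1)⁻¹`); §2 ★★★
`ne2PlusSite_sSiteExOn_of_speciesLettersF` (part VI's socket ∘ §1).

HONEST FRAMING.  Count-neutral, species-independent BRIDGE; no new estimate; BOTH species are BINDERS (no lane has typed an averaging species for the scalar site layer yet — dag-n15-c F7∕F9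
did it for the vector piece); the propagator, its dressing and the perturbed matrix `Q′G′²Q′*` are the genuine ∕ model-exact objects of parts VII–IX.  NOT [B9] Thm 3.2 at a general
(3.35)-regular `U` (NE2⁺ NOT PRINTED as an η-rate); Node 00's [B9] layers of record are residual — **N15 is NOT discharged** (typed 28∕28 · discharged 5∕27 of record unchanged); K3⁷ OPEN;
one finite four-torus programme at fixed `ε` — NOT ℝ⁴, NOT infinite volume, NOT OS, NOT a mass gap, NOT Clay; R4 closes the conditional finite-𝕋⁴ rung `BalabanLadder.UV` only.  Restate-immune.
-/

set_option autoImplicit false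

noncomputable section

open scoped BigOperators Matrix
open Finset

namespace Summit.QuantumFields.YangMills.BalabanUVNodes.N15.SiteLayerBg

open Literature.MathematicalPhysics.QuantumFieldTheory.Balaban1983to89
open Literature.MathematicalPhysics.QuantumFieldTheory.Balaban1983to89.B11SectG (BlockNorm HasMaj RowSum)
open Literature.MathematicalPhysics.QuantumFieldTheory.Balaban1983to89.T4EtaRate (PairedInstance EtaPairing NE2PlusSite)
open Literature.MathematicalPhysics.QuantumFieldTheory.Balaban1983to89.T4EtaRateDefect (idef)
open Literature.MathematicalPhysics.QuantumFieldTheory.Balaban1983to89.T4EtaRateCoeffDefect (pull diagK diagK_nonneg diagK_mono fibre)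
open Literature.MathematicalPhysics.QuantumFieldTheory.Balaban1983to89.B5Prop11Plancherel (Tor fine)
open Literature.MathematicalPhysics.QuantumFieldTheory.Balaban1983to89.B4Sect5Torus (tdist)
open Literature.MathematicalPhysics.QuantumFieldTheory.Balaban1983to89.B4Sect5Proof (latticeConst latticeConst_nonneg)
open Literature.MathematicalPhysics.QuantumFieldTheory.Balaban1983to89.B5QGGQ145Bounds (Idx qggqRe)
open Literature.MathematicalPhysics.QuantumFieldTheory.Balaban1983to89.B6UnitTorusCarrier (unitTorusGeo triangle254_unitTorusGeo rowSum_unitTorusGeo)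
open Literature.MathematicalPhysics.QuantumFieldTheory.Balaban1983to89.B9SectDSup (inv_one_sub_le_two)
open Literature.MathematicalPhysics.QuantumFieldTheory.King1986 (aK aK_pos)
open Literature.MathematicalPhysics.QuantumFieldTheory.King1986.Torus (fineOp blockOf tdistT tdistT_nonneg)
open Summit.QuantumFields.YangMills.BalabanUVNodes.N15.VectorPiece (unitTorusGeoS unitTorusGeoS_dist)
open Summit.QuantumFields.YangMills.BalabanUVNodes.N15.OperatorReadout (opGeo)
open Summit.QuantumFields.YangMills.BalabanUVNodes.N15.BackgroundLayer (blkPair liftPair bgConst bgConst_nonneg)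
open Summit.QuantumFields.YangMills.BalabanUVNodes.N15.SiteLayer (siteForm dressedOp hasMaj_dressedOp hasMaj_dressedOp_sub hasMaj_idef_dressedOp)
open Summit.QuantumFields.YangMills.BalabanUVNodes.N15.DefectKernel (card_fibre_kingProj)
open Summit.QuantumFields.YangMills.BalabanUVNodes.N15KingModelRung.Curved (kingGOp kingDOp underPtN val_underPtN)

variable {d : ℕ} {L : ℕ}


/-! ## §1 ★★★ The sockets' three site letters from the two species' letters (averaging species live) -/

section Letters

variable [NeZero L] {I : Type} (Mn : I → Fin (d + 1) → ℕ) [hMn0 : ∀ i μ, NeZero (Mn i μ)] (kk mm : I → ℕ) (Msz : I → ℝ) (Bc Bf : I → B9.Backgrounds)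
  (avg : ∀ i, (Bf i).Cfg → (Bc i).Cfg)
  (Vc : ∀ i, (Bc i).Cfg → ((Tor (fine (L ^ kk i) (Mn i)) × Option (Fin (d + 1)) → ℝ) →ₗ[ℝ] (Tor (fine (L ^ kk i) (Mn i)) → ℝ)))
  (Vf : ∀ i, (Bf i).Cfg → ((Tor (fine (L ^ mm i * L ^ kk i) (Mn i)) × Option (Fin (d + 1)) → ℝ) →ₗ[ℝ] (Tor (fine (L ^ mm i * L ^ kk i) (Mn i)) → ℝ)))
  (Fc : ∀ i, (Bc i).Cfg → (Tor (fine (L ^ kk i) (Mn i)) → ℝ) →ₗ[ℝ] (Tor (Mn i) → ℝ)) (Fsc : ∀ i, (Bc i).Cfg → (Tor (Mn i) → ℝ) →ₗ[ℝ] (Tor (fine (L ^ kk i) (Mn i)) → ℝ))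
  (Ff : ∀ i, (Bf i).Cfg → (Tor (fine (L ^ mm i * L ^ kk i) (Mn i)) → ℝ) →ₗ[ℝ] (Tor (Mn i) → ℝ))
  (Fsf : ∀ i, (Bf i).Cfg → (Tor (Mn i) → ℝ) →ₗ[ℝ] (Tor (fine (L ^ mm i * L ^ kk i) (Mn i)) → ℝ))

/-- ★★★ **THE THREE SITE LETTERS FROM THE TWO SPECIES' LETTERS, AVERAGING SPECIES LIVE** — part IX's `siteLetters_of_speciesLetters` with part VI's averaging words: HYPOTHESES = the
first-order species' three diagonal letters (`hV`, as in part IX) AND the averaging species' six block-local letters (`hF`: sizes `Fc(Ū), Fsc(Ū), Ff(U), Fsf(U) ≤ diagK (r₀α₀)`, fits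
`𝔇(Ff(U), Fc(Ū)), 𝔇(Fsf(U), Fsc(Ū)) ≤ diagK (o₀(L^k)^{−γ∕2})` under `Reg335 c₃₅ α₀ U`, `α₀ ≤ a₂`); CONCLUSION = part II∕IV's `hP` for the FULL (3.65) perturbations
`siteEntries (sitePert365F blockOf F F* G′ (dressedOp G′ D V̂))` of THE massless scalar site propagator (parts VII∕VIII), rate exponent `γ∕2`.
[cite: Balaban1985BackgroundPropagators, (3.58) p.402, (3.63)–(3.67) pp.402–403 (mechanism), Thm 3.2 (3.48) p.398; King1986, Prop. 3.8 (3.71) p.664] -/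
theorem siteLettersF_of_speciesLetters (hLodd : Odd L) (hL2 : 2 ≤ L) {aS : ℝ} (haS : 0 < aS) (c35 : ℝ) {γ : ℝ} (hγ0 : 0 < γ) (hγ1 : γ < 1)
    {mT : I → ℕ} (hMnT : ∀ i μ, Mn i μ = 2 * L ^ mT i) (hk : ∀ i, 1 ≤ kk i) (hm : ∀ i, 1 ≤ mm i)
    (hV : ∃ K a₁ : ℝ, 0 ≤ K ∧ 0 < a₁ ∧ ∀ (i : I) (α₀ : ℝ), 0 < α₀ → α₀ ≤ a₁ → ∀ U : (Bf i).Cfg, (Bf i).Reg335 c35 α₀ U →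
      HasMaj (BlockNorm.ofBlocks (unitTorusGeoS L (kk i) (Mn i) (Msz i)) (blkPair (blockOf (L ^ kk i) (Mn i))))
        (BlockNorm.ofBlocks (unitTorusGeoS L (kk i) (Mn i) (Msz i)) (blockOf (L ^ kk i) (Mn i))) (Vc i (avg i U)) (diagK fun _ => K * α₀) ∧
      HasMaj (BlockNorm.ofBlocks (unitTorusGeoS L (kk i) (Mn i) (Msz i)) (blkPair (blockOf (L ^ kk i) (Mn i) ∘ underPtN L (kk i) (mm i) (Mn i))))
        (BlockNorm.ofBlocks (unitTorusGeoS L (kk i) (Mn i) (Msz i)) (blockOf (L ^ kk i) (Mn i) ∘ underPtN L (kk i) (mm i) (Mn i))) (Vf i U) (diagK fun _ => K * α₀) ∧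
      HasMaj (BlockNorm.ofBlocks (unitTorusGeoS L (kk i) (Mn i) (Msz i)) (blkPair (blockOf (L ^ kk i) (Mn i))))
        (BlockNorm.ofBlocks (unitTorusGeoS L (kk i) (Mn i) (Msz i)) (blockOf (L ^ kk i) (Mn i) ∘ underPtN L (kk i) (mm i) (Mn i)))
        (idef (pull (liftPair (underPtN L (kk i) (mm i) (Mn i)))) (pull (underPtN L (kk i) (mm i) (Mn i))) (Vf i U) (Vc i (avg i U)))
        (diagK fun _ => K * α₀ * ((L : ℝ) ^ kk i) ^ (-(γ / 2))))
    (hF : ∃ r₀ o₀ a₂ : ℝ, 0 ≤ r₀ ∧ 0 ≤ o₀ ∧ 0 < a₂ ∧ ∀ (i : I) (α₀ : ℝ), 0 < α₀ → α₀ ≤ a₂ → ∀ U : (Bf i).Cfg, (Bf i).Reg335 c35 α₀ U →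
      HasMaj (BlockNorm.ofBlocks (unitTorusGeoS L (kk i) (Mn i) (Msz i)) (blockOf (L ^ kk i) (Mn i))) (BlockNorm.ofBlocks (unitTorusGeoS L (kk i) (Mn i) (Msz i)) (fun y : Tor (Mn i) => y))
        (Fc i (avg i U)) (diagK fun _ => r₀ * α₀) ∧
      HasMaj (BlockNorm.ofBlocks (unitTorusGeoS L (kk i) (Mn i) (Msz i)) (fun y : Tor (Mn i) => y)) (BlockNorm.ofBlocks (unitTorusGeoS L (kk i) (Mn i) (Msz i)) (blockOf (L ^ kk i) (Mn i)))
        (Fsc i (avg i U)) (diagK fun _ => r₀ * α₀) ∧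
      HasMaj (BlockNorm.ofBlocks (unitTorusGeoS L (kk i) (Mn i) (Msz i)) (blockOf (L ^ kk i) (Mn i) ∘ underPtN L (kk i) (mm i) (Mn i)))
        (BlockNorm.ofBlocks (unitTorusGeoS L (kk i) (Mn i) (Msz i)) (fun y : Tor (Mn i) => y)) (Ff i U) (diagK fun _ => r₀ * α₀) ∧
      HasMaj (BlockNorm.ofBlocks (unitTorusGeoS L (kk i) (Mn i) (Msz i)) (fun y : Tor (Mn i) => y))
        (BlockNorm.ofBlocks (unitTorusGeoS L (kk i) (Mn i) (Msz i)) (blockOf (L ^ kk i) (Mn i) ∘ underPtN L (kk i) (mm i) (Mn i))) (Fsf i U) (diagK fun _ => r₀ * α₀) ∧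
      HasMaj (BlockNorm.ofBlocks (unitTorusGeoS L (kk i) (Mn i) (Msz i)) (blockOf (L ^ kk i) (Mn i))) (BlockNorm.ofBlocks (unitTorusGeoS L (kk i) (Mn i) (Msz i)) (fun y : Tor (Mn i) => y))
        (idef (pull (underPtN L (kk i) (mm i) (Mn i))) LinearMap.id (Ff i U) (Fc i (avg i U))) (diagK fun _ => o₀ * ((L : ℝ) ^ kk i) ^ (-(γ / 2))) ∧
      HasMaj (BlockNorm.ofBlocks (unitTorusGeoS L (kk i) (Mn i) (Msz i)) (fun y : Tor (Mn i) => y))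
        (BlockNorm.ofBlocks (unitTorusGeoS L (kk i) (Mn i) (Msz i)) (blockOf (L ^ kk i) (Mn i) ∘ underPtN L (kk i) (mm i) (Mn i)))
        (idef LinearMap.id (pull (underPtN L (kk i) (mm i) (Mn i))) (Fsf i U) (Fsc i (avg i U))) (diagK fun _ => o₀ * ((L : ℝ) ^ kk i) ^ (-(γ / 2)))) :
    ∃ δP ζ τ a₁ : ℝ, 0 < δP ∧ 0 < ζ ∧ 0 < τ ∧ 0 < a₁ ∧
      ∀ (i : I) (α₀ : ℝ), 0 < α₀ → α₀ ≤ a₁ → ∀ U : (Bf i).Cfg, (Bf i).Reg335 c35 α₀ U →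
        (∀ p p' : Idx (Mn i), |siteEntries (Mn i) (sitePert365F (Mn i) (blockOf (L ^ kk i) (Mn i)) (Fc i (avg i U)) (Fsc i (avg i U)) (kingGOp L aS 0 (kk i) (L ^ kk i) (Mn i))
            (dressedOp (kingGOp L aS 0 (kk i) (L ^ kk i) (Mn i)) (fun μ => kingDOp L aS 0 (kk i) (L ^ kk i) (Mn i) μ) (Vc i (avg i U)))) p p'|
            ≤ ζ * α₀ * Real.exp (-(δP * tdist (Mn i) p p'))) ∧
        (∀ p p' : Idx (Mn i), |siteEntries (Mn i) (sitePert365F (Mn i) (blockOf (L ^ kk i) (Mn i) ∘ underPtN L (kk i) (mm i) (Mn i)) (Ff i U) (Fsf i U)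
            (kingGOp L aS 0 (kk i + mm i) (L ^ mm i * L ^ kk i) (Mn i))
            (dressedOp (kingGOp L aS 0 (kk i + mm i) (L ^ mm i * L ^ kk i) (Mn i)) (fun μ => kingDOp L aS 0 (kk i + mm i) (L ^ mm i * L ^ kk i) (Mn i) μ) (Vf i U))) p p'|
            ≤ ζ * α₀ * Real.exp (-(δP * tdist (Mn i) p p'))) ∧
        (∀ p p' : Idx (Mn i), |siteEntries (Mn i) (sitePert365F (Mn i) (blockOf (L ^ kk i) (Mn i) ∘ underPtN L (kk i) (mm i) (Mn i)) (Ff i U) (Fsf i U)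
              (kingGOp L aS 0 (kk i + mm i) (L ^ mm i * L ^ kk i) (Mn i))
              (dressedOp (kingGOp L aS 0 (kk i + mm i) (L ^ mm i * L ^ kk i) (Mn i)) (fun μ => kingDOp L aS 0 (kk i + mm i) (L ^ mm i * L ^ kk i) (Mn i) μ) (Vf i U))) p p'
            - siteEntries (Mn i) (sitePert365F (Mn i) (blockOf (L ^ kk i) (Mn i)) (Fc i (avg i U)) (Fsc i (avg i U)) (kingGOp L aS 0 (kk i) (L ^ kk i) (Mn i))
              (dressedOp (kingGOp L aS 0 (kk i) (L ^ kk i) (Mn i)) (fun μ => kingDOp L aS 0 (kk i) (L ^ kk i) (Mn i) μ) (Vc i (avg i U)))) p p'|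
            ≤ τ * ((L : ℝ) ^ kk i) ^ (-(γ / 2)) * Real.exp (-(δP * tdist (Mn i) p p'))) := by
  obtain ⟨β, δ, m₀, hβ, hδ, hm₀, HU⟩ := kingScalarLayer_massless_letters (d := d) L hLodd hL2 haS hγ0.le hγ1
  obtain ⟨K, a₁, hK, ha₁, HV⟩ := hV
  obtain ⟨r₀, o₀, a₂, hr₀, ho₀, ha₂, HFs⟩ := hF
  -- the Combes–Thomas row sum at `σ = δ∕2`, the threshold
  set cr : ℝ := latticeConst (d + 1) (δ / 2) with hcr_def
  have hcr : 0 ≤ cr := latticeConst_nonneg _ (by positivity)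
  set a₁' : ℝ := min (min a₁ a₂) (1 / (2 * β * K * cr + 1)) with ha₁'_def
  have hden : 0 < 2 * β * K * cr + 1 := by positivity
  have ha₁' : 0 < a₁' := lt_min (lt_min ha₁ ha₂) (by positivity)
  have ha₁'a₁ : a₁' ≤ a₁ := (min_le_left _ _).trans (min_le_left _ _)
  have ha₁'a₂ : a₁' ≤ a₂ := (min_le_left _ _).trans (min_le_right _ _)
  have hguard : β * (K * a₁') * cr ≤ 1 / 2 := by
    have h1 : a₁' ≤ 1 / (2 * β * K * cr + 1) := min_le_right _ _
    have h2 : β * K * cr * a₁' ≤ β * K * cr * (1 / (2 * β * K * cr + 1)) := mul_le_mul_of_nonneg_left h1 (by positivity)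
    have h3 : β * K * cr * (1 / (2 * β * K * cr + 1)) ≤ 1 / 2 := by
      rw [mul_one_div, div_le_iff₀ hden]; linarith [mul_nonneg (mul_nonneg hβ.le hK) hcr]
    linarith
  refine siteLettersF_of_dressedLetters (L := L) Mn kk Msz (fun i => Tor (fine (L ^ kk i) (Mn i))) (fun i => Tor (fine (L ^ mm i * L ^ kk i) (Mn i)))
    (fun i => blockOf (L ^ kk i) (Mn i)) (fun i => underPtN L (kk i) (mm i) (Mn i)) Bc Bf avg
    (fun i => kingGOp L aS 0 (kk i) (L ^ kk i) (Mn i)) (fun i => kingGOp L aS 0 (kk i + mm i) (L ^ mm i * L ^ kk i) (Mn i))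
    (fun i V => dressedOp (kingGOp L aS 0 (kk i) (L ^ kk i) (Mn i)) (fun μ => kingDOp L aS 0 (kk i) (L ^ kk i) (Mn i) μ) (Vc i V))
    (fun i U => dressedOp (kingGOp L aS 0 (kk i + mm i) (L ^ mm i * L ^ kk i) (Mn i)) (fun μ => kingDOp L aS 0 (kk i + mm i) (L ^ mm i * L ^ kk i) (Mn i) μ) (Vf i U))
    Fc Fsc Ff Fsf c35 (γP := γ / 2) (fun i => card_fibre_underPtN_ne (L := L) (kk i) (mm i) (Mn i))
    ⟨β, 2 * β, 2 * β ^ 2 * K * cr + 1, bgConst β cr m₀ K a₁', m₀, r₀, o₀, δ / 2, a₁', hβ.le, by positivity, by positivity, bgConst_nonneg hβ.le hcr hm₀.le hK ha₁'.le, hm₀.le,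
      hr₀, ho₀, half_pos hδ, ha₁', fun i => ?_⟩
  obtain ⟨hG, hD, hG', hD', hDG, hDD⟩ := HU (kk i) (hk i) (mm i) (hm i) (mT i) (Mn i) (hMnT i) (Msz i)
  -- carrier facts
  have htri := triangle254_unitTorusGeo L (kk i) (Mn i)
  have hrow := rowSum_unitTorusGeo L (kk i) (Mn i) (half_pos hδ)
  have hd : ∀ a b : (unitTorusGeoS L (kk i) (Mn i) (Msz i)).Site, 0 ≤ (unitTorusGeoS L (kk i) (Mn i) (Msz i)).dist a b := fun a b => tdistT_nonneg (Mn i) a b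
  have hθ : 0 ≤ ((L : ℝ) ^ kk i) ^ (-(γ / 2)) := Real.rpow_nonneg (pow_nonneg (Nat.cast_nonneg _) _) _
  -- weakening the `U ≡ 1` letters from rate `δ` to `δ∕2`
  have wk : ∀ {C : ℝ}, 0 ≤ C → ∀ y y' : Tor (Mn i), C * Real.exp (-(δ * tdistT (Mn i) y y')) ≤ C * Real.exp (-(δ / 2 * (unitTorusGeoS L (kk i) (Mn i) (Msz i)).dist y y')) :=
    fun hC y y' => mul_le_mul_of_nonneg_left (Real.exp_le_exp.mpr (neg_le_neg (by
      rw [unitTorusGeoS_dist]; exact mul_le_mul_of_nonneg_right (by linarith) (tdistT_nonneg (Mn i) y y')))) hC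
  have wkd : ∀ y y' : Tor (Mn i), m₀ * ((L : ℝ) ^ kk i) ^ (-(γ / 2)) * Real.exp (-(δ * tdistT (Mn i) y y'))
      ≤ m₀ * ((L : ℝ) ^ kk i) ^ (-(γ / 2)) * Real.exp (-(δ / 2 * (unitTorusGeoS L (kk i) (Mn i) (Msz i)).dist y y')) := wk (mul_nonneg hm₀.le hθ)
  refine ⟨hG.mono (wk hβ.le), hG'.mono (wk hβ.le), hDG.mono wkd, fun α₀ hα₀ hαa U hreg => ?_⟩
  obtain ⟨hVc, hVf, hDV⟩ := HV i α₀ hα₀ (hαa.trans ha₁'a₁) U hreg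
  obtain ⟨hF1, hF2, hF3, hF4, hF5, hF6⟩ := HFs i α₀ hα₀ (hαa.trans ha₁'a₂) U hreg
  have hR : 0 ≤ K * α₀ := mul_nonneg hK hα₀.le
  have hq : β * (K * α₀) * cr ≤ 1 / 2 := (mul_le_mul_of_nonneg_right (mul_le_mul_of_nonneg_left (mul_le_mul_of_nonneg_left hαa hK) hβ.le) hcr).trans hguard
  have hq1 : β * (K * α₀) * cr < 1 := by linarith
  have hinv : (1 - β * (K * α₀) * cr)⁻¹ ≤ 2 := inv_one_sub_le_two hq
  have hinv0 : 0 ≤ (1 - β * (K * α₀) * cr)⁻¹ := inv_nonneg.2 (by linarith)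
  have hρδ : δ / 2 + δ / 2 ≤ δ := by linarith
  -- S4's three dressing theorems, coarse and fine, with the `U ≡ 1` letters at rate `δ` and `σ = ρ = δ∕2`
  have hXc := hasMaj_dressedOp (g := unitTorusGeoS L (kk i) (Mn i) (Msz i)) (blockOf (L ^ kk i) (Mn i)) htri hd hrow (by positivity) (by positivity : (0 : ℝ) ≤ δ / 2) hρδ
    hβ.le hR hG hD hVc hq1
  have hXf := hasMaj_dressedOp (g := unitTorusGeoS L (kk i) (Mn i) (Msz i)) (blockOf (L ^ kk i) (Mn i) ∘ underPtN L (kk i) (mm i) (Mn i)) htri hd hrow (by positivity)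
    (by positivity : (0 : ℝ) ≤ δ / 2) hρδ hβ.le hR hG' hD' hVf hq1
  have hEc := hasMaj_dressedOp_sub (g := unitTorusGeoS L (kk i) (Mn i) (Msz i)) (blockOf (L ^ kk i) (Mn i)) htri hd hrow (by positivity) (by positivity : (0 : ℝ) ≤ δ / 2) hρδ
    hβ.le hR hG hD hVc hq1
  have hEf := hasMaj_dressedOp_sub (g := unitTorusGeoS L (kk i) (Mn i) (Msz i)) (blockOf (L ^ kk i) (Mn i) ∘ underPtN L (kk i) (mm i) (Mn i)) htri hd hrow (by positivity)
    (by positivity : (0 : ℝ) ≤ δ / 2) hρδ hβ.le hR hG' hD' hVf hq1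
  have hDX := hasMaj_idef_dressedOp (g := unitTorusGeoS L (kk i) (Mn i) (Msz i)) (blockOf (L ^ kk i) (Mn i)) (underPtN L (kk i) (mm i) (Mn i)) htri hd hrow (by positivity) hcr
    (K := K) (a₀ := α₀) (by linarith : δ / 2 ≤ δ) hβ.le hm₀.le hθ hq hR le_rfl hG hD hG' hD' hDG hDD hVc hVf hDV
  refine ⟨hXc.mono fun y y' => ?_, hXf.mono fun y y' => ?_, hEc.mono fun y y' => ?_, hEf.mono fun y y' => ?_, hDX.mono fun y y' => ?_, hF1, hF2, hF3, hF4, hF5, hF6⟩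
  · exact mul_le_mul_of_nonneg_right ((mul_le_mul_of_nonneg_left hinv hβ.le).trans_eq (mul_comm β 2)) (Real.exp_nonneg _)
  · exact mul_le_mul_of_nonneg_right ((mul_le_mul_of_nonneg_left hinv hβ.le).trans_eq (mul_comm β 2)) (Real.exp_nonneg _)
  · refine mul_le_mul_of_nonneg_right ?_ (Real.exp_nonneg _)
    have h1 : β * (K * α₀ * (β * (1 - β * (K * α₀) * cr)⁻¹)) * cr = (β * β * K * cr * (1 - β * (K * α₀) * cr)⁻¹) * α₀ := by ring
    rw [h1]
    refine mul_le_mul_of_nonneg_right ?_ hα₀.le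
    linarith [mul_le_mul_of_nonneg_left hinv (show 0 ≤ β * β * K * cr by positivity)]
  · refine mul_le_mul_of_nonneg_right ?_ (Real.exp_nonneg _)
    have h1 : β * (K * α₀ * (β * (1 - β * (K * α₀) * cr)⁻¹)) * cr = (β * β * K * cr * (1 - β * (K * α₀) * cr)⁻¹) * α₀ := by ring
    rw [h1]
    refine mul_le_mul_of_nonneg_right ?_ hα₀.le
    linarith [mul_le_mul_of_nonneg_left hinv (show 0 ≤ β * β * K * cr by positivity)]
  · have hsub : δ - δ / 2 = δ / 2 := by ring
    rw [hsub]
    exact mul_le_mul_of_nonneg_right (mul_le_mul_of_nonneg_right (bgConst_mono_a₀ hβ.le hcr hm₀.le hK hαa) hθ) (Real.exp_nonneg _)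


end Letters

/-! ## §2 ★★★ `NE2PlusSite` from the two species' letters (part IV's socket ∘ §1) -/

section Socket

variable [NeZero L] {I : Type} (Mn : I → Fin (d + 1) → ℕ) [hMn0 : ∀ i μ, NeZero (Mn i μ)] (kk mm : I → ℕ) (Msz : I → ℝ) (X : I → Type) [∀ i, Fintype (X i)]
  (blk : ∀ i, X i → Tor (Mn i)) (gf : I → B9.Geometry) (Bc Bf : I → B9.Backgrounds)
  (Vc : ∀ i, (Bc i).Cfg → ((Tor (fine (L ^ kk i) (Mn i)) × Option (Fin (d + 1)) → ℝ) →ₗ[ℝ] (Tor (fine (L ^ kk i) (Mn i)) → ℝ)))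
  (Vf : ∀ i, (Bf i).Cfg → ((Tor (fine (L ^ mm i * L ^ kk i) (Mn i)) × Option (Fin (d + 1)) → ℝ) →ₗ[ℝ] (Tor (fine (L ^ mm i * L ^ kk i) (Mn i)) → ℝ)))
  (Fc : ∀ i, (Bc i).Cfg → (Tor (fine (L ^ kk i) (Mn i)) → ℝ) →ₗ[ℝ] (Tor (Mn i) → ℝ)) (Fsc : ∀ i, (Bc i).Cfg → (Tor (Mn i) → ℝ) →ₗ[ℝ] (Tor (fine (L ^ kk i) (Mn i)) → ℝ))
  (Ff : ∀ i, (Bf i).Cfg → (Tor (fine (L ^ mm i * L ^ kk i) (Mn i)) → ℝ) →ₗ[ℝ] (Tor (Mn i) → ℝ))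
  (Fsf : ∀ i, (Bf i).Cfg → (Tor (Mn i) → ℝ) →ₗ[ℝ] (Tor (fine (L ^ mm i * L ^ kk i) (Mn i)) → ℝ))

/-- ★★★ **`NE2PlusSite` WITH THE BACKGROUND LIVE, AVERAGING SPECIES LIVE, FROM THE TWO SPECIES' LETTERS ALONE** — part IV's `ne2PlusSite_sSiteExOn_of_letters` fed by §1: the dressed
site kernels `(Q′G′²Q′*_{L^mL^k} + P_f(U))⁻¹ − (Q′G′²Q′*_{L^k} + P_c(Ū))⁻¹` with the FULL (3.65) perturbations `P = siteEntries (sitePert365F blockOf F F* G′ X(U))` of THE massless scalar site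
propagator satisfy `NE2PlusSite d′ p c₃₅` on any family over the sized carriers. [cite: Balaban1985BackgroundPropagators, Thm 3.2 (3.48) p.398 + Thm 3.14 pp.426–427 (quantifier template), (3.58) p.402, (3.63)–(3.67) pp.402–403 (mechanism); Balaban1984PropagatorsI, (1.45) p.26; King1986, Prop. 3.8 (3.71) p.664; CombesThomas1973, §II] -/
theorem ne2PlusSite_sSiteExOn_of_speciesLettersF (hLodd : Odd L) (hL2 : 2 ≤ L) {aS : ℝ} (haS : 0 < aS) (c35 : ℝ) (d' : ℕ) (p : ℝ) {γ : ℝ} (hγ0 : 0 < γ) (hγ1 : γ < 1)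
    {mT : I → ℕ} (hMnT : ∀ i μ, Mn i μ = 2 * L ^ mT i) (hk : ∀ i, 1 ≤ kk i) (hm : ∀ i, 1 ≤ mm i) (hM : ∀ i, 1 ≤ (gf i).M)
    (pair : ∀ i, EtaPairing (opGeo (unitTorusGeoS L (kk i) (Mn i) (Msz i)) (X i) (blk i)) (gf i) (Bc i) (Bf i))
    (hV : ∃ K a₁ : ℝ, 0 ≤ K ∧ 0 < a₁ ∧ ∀ (i : I) (α₀ : ℝ), 0 < α₀ → α₀ ≤ a₁ → ∀ U : (Bf i).Cfg, (Bf i).Reg335 c35 α₀ U →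
      HasMaj (BlockNorm.ofBlocks (unitTorusGeoS L (kk i) (Mn i) (Msz i)) (blkPair (blockOf (L ^ kk i) (Mn i))))
        (BlockNorm.ofBlocks (unitTorusGeoS L (kk i) (Mn i) (Msz i)) (blockOf (L ^ kk i) (Mn i))) (Vc i ((pair i).avg U)) (diagK fun _ => K * α₀) ∧
      HasMaj (BlockNorm.ofBlocks (unitTorusGeoS L (kk i) (Mn i) (Msz i)) (blkPair (blockOf (L ^ kk i) (Mn i) ∘ underPtN L (kk i) (mm i) (Mn i))))
        (BlockNorm.ofBlocks (unitTorusGeoS L (kk i) (Mn i) (Msz i)) (blockOf (L ^ kk i) (Mn i) ∘ underPtN L (kk i) (mm i) (Mn i))) (Vf i U) (diagK fun _ => K * α₀) ∧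
      HasMaj (BlockNorm.ofBlocks (unitTorusGeoS L (kk i) (Mn i) (Msz i)) (blkPair (blockOf (L ^ kk i) (Mn i))))
        (BlockNorm.ofBlocks (unitTorusGeoS L (kk i) (Mn i) (Msz i)) (blockOf (L ^ kk i) (Mn i) ∘ underPtN L (kk i) (mm i) (Mn i)))
        (idef (pull (liftPair (underPtN L (kk i) (mm i) (Mn i)))) (pull (underPtN L (kk i) (mm i) (Mn i))) (Vf i U) (Vc i ((pair i).avg U)))
        (diagK fun _ => K * α₀ * ((L : ℝ) ^ kk i) ^ (-(γ / 2))))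
    (hF : ∃ r₀ o₀ a₂ : ℝ, 0 ≤ r₀ ∧ 0 ≤ o₀ ∧ 0 < a₂ ∧ ∀ (i : I) (α₀ : ℝ), 0 < α₀ → α₀ ≤ a₂ → ∀ U : (Bf i).Cfg, (Bf i).Reg335 c35 α₀ U →
      HasMaj (BlockNorm.ofBlocks (unitTorusGeoS L (kk i) (Mn i) (Msz i)) (blockOf (L ^ kk i) (Mn i))) (BlockNorm.ofBlocks (unitTorusGeoS L (kk i) (Mn i) (Msz i)) (fun y : Tor (Mn i) => y))
        (Fc i ((pair i).avg U)) (diagK fun _ => r₀ * α₀) ∧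
      HasMaj (BlockNorm.ofBlocks (unitTorusGeoS L (kk i) (Mn i) (Msz i)) (fun y : Tor (Mn i) => y)) (BlockNorm.ofBlocks (unitTorusGeoS L (kk i) (Mn i) (Msz i)) (blockOf (L ^ kk i) (Mn i)))
        (Fsc i ((pair i).avg U)) (diagK fun _ => r₀ * α₀) ∧
      HasMaj (BlockNorm.ofBlocks (unitTorusGeoS L (kk i) (Mn i) (Msz i)) (blockOf (L ^ kk i) (Mn i) ∘ underPtN L (kk i) (mm i) (Mn i)))
        (BlockNorm.ofBlocks (unitTorusGeoS L (kk i) (Mn i) (Msz i)) (fun y : Tor (Mn i) => y)) (Ff i U) (diagK fun _ => r₀ * α₀) ∧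
      HasMaj (BlockNorm.ofBlocks (unitTorusGeoS L (kk i) (Mn i) (Msz i)) (fun y : Tor (Mn i) => y))
        (BlockNorm.ofBlocks (unitTorusGeoS L (kk i) (Mn i) (Msz i)) (blockOf (L ^ kk i) (Mn i) ∘ underPtN L (kk i) (mm i) (Mn i))) (Fsf i U) (diagK fun _ => r₀ * α₀) ∧
      HasMaj (BlockNorm.ofBlocks (unitTorusGeoS L (kk i) (Mn i) (Msz i)) (blockOf (L ^ kk i) (Mn i))) (BlockNorm.ofBlocks (unitTorusGeoS L (kk i) (Mn i) (Msz i)) (fun y : Tor (Mn i) => y))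
        (idef (pull (underPtN L (kk i) (mm i) (Mn i))) LinearMap.id (Ff i U) (Fc i ((pair i).avg U))) (diagK fun _ => o₀ * ((L : ℝ) ^ kk i) ^ (-(γ / 2))) ∧
      HasMaj (BlockNorm.ofBlocks (unitTorusGeoS L (kk i) (Mn i) (Msz i)) (fun y : Tor (Mn i) => y))
        (BlockNorm.ofBlocks (unitTorusGeoS L (kk i) (Mn i) (Msz i)) (blockOf (L ^ kk i) (Mn i) ∘ underPtN L (kk i) (mm i) (Mn i)))
        (idef LinearMap.id (pull (underPtN L (kk i) (mm i) (Mn i))) (Fsf i U) (Fsc i ((pair i).avg U))) (diagK fun _ => o₀ * ((L : ℝ) ^ kk i) ^ (-(γ / 2)))) :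
    NE2PlusSite d' p c35 (fun i => (⟨opGeo (unitTorusGeoS L (kk i) (Mn i) (Msz i)) (X i) (blk i), gf i, Bc i, Bf i, pair i⟩ : PairedInstance))
      (sSiteExOn Mn kk mm Msz X blk gf Bc Bf aS pair
        (fun i U => siteEntries (Mn i) (sitePert365F (Mn i) (blockOf (L ^ kk i) (Mn i) ∘ underPtN L (kk i) (mm i) (Mn i)) (Ff i U) (Fsf i U)
          (kingGOp L aS 0 (kk i + mm i) (L ^ mm i * L ^ kk i) (Mn i))
          (dressedOp (kingGOp L aS 0 (kk i + mm i) (L ^ mm i * L ^ kk i) (Mn i)) (fun μ => kingDOp L aS 0 (kk i + mm i) (L ^ mm i * L ^ kk i) (Mn i) μ) (Vf i U))))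
        (fun i V => siteEntries (Mn i) (sitePert365F (Mn i) (blockOf (L ^ kk i) (Mn i)) (Fc i V) (Fsc i V) (kingGOp L aS 0 (kk i) (L ^ kk i) (Mn i))
          (dressedOp (kingGOp L aS 0 (kk i) (L ^ kk i) (Mn i)) (fun μ => kingDOp L aS 0 (kk i) (L ^ kk i) (Mn i) μ) (Vc i V))))) :=
  ne2PlusSite_sSiteExOn_of_letters Mn kk mm Msz X blk gf Bc Bf hLodd hL2 haS c35 d' p hMnT hk hM pair _ _ (half_pos hγ0)
    (siteLettersF_of_speciesLetters (L := L) Mn kk mm Msz Bc Bf (fun i => (pair i).avg) Vc Vf Fc Fsc Ff Fsf hLodd hL2 haS c35 hγ0 hγ1 hMnT hk hm hV hF)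

end Socket

end Summit.QuantumFields.YangMills.BalabanUVNodes.N15.SiteLayerBg

end
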